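import Mathlib

/-!
# The archimedean convention `z̄/|z| = (z/|z|)⁻¹`: Liu's `arg(z)^{−w_τ}` at `w_τ = 1` is DR's `z̄_v/|z_v|` (T3.3 / T3.5)

Blind re-derivation cell `pub-hodge-repro`, Tier 3, seat `t3-p2` (prover-pub-hodge-repro-t3-p2-g12-0), sub-goal T3.3 of
`route/TIER3.md` (§7 R-a, `proofs/t3-p2/R3R4-INSTANTIATION.md` §2(i) / §3 R-a: «λ_∞(z) = ∏_{v∈Φ_j} z̄_v/|z_v| … its
weight is w_τ = 1 at every τ (z̄/|z| = (z/|z|)^{−1})», joining Dimitrov–Ramakrishnan 2015 Lemma 3.5 (print p. 1198) to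
Liu 2021's archimedean formula (journal print p0041:L24–31 «μ_τ … is the character z ↦ arg(z)^{−w_τ}», with
p0006:L6–7 «arg(z) := z/√(z z̄)»)).  Target tree path `lean/Summits/Ventures/HodgeRepro/Tier3ArchimedeanConvention.lean`;
`import Mathlib` only.

The elementary core, on the kernel — two unit-circle projections of `z ≠ 0` are mutually inverse:

* `mul_conj_re`, `sqrt_normSq_eq_norm`, `liu_arg_eq_div_norm` — Liu's `arg(z) = z/√(z z̄)` is `z/‖z‖`
  (`z z̄ = |z|²` as a real number);
* `norm_div_norm` — `z/‖z‖` lies on the unit circle;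
* `conj_div_norm_eq_inv` — **`z̄/|z| = (z/|z|)⁻¹`**; `zpow_neg_one_div_norm` — Liu's `arg(z)^{−1}` is DR's `z̄/|z|`
  (`w_τ = 1`); `zpow_neg_natCast_div_norm` — `arg(z)^{−w} = (z̄/|z|)^w` for every `w`;
* `conj_div_norm_conj` — DR's formula at the conjugate embedding reverses the exponent: `conj(z̄)/|z̄| = z/|z| =
  (z̄/|z|)⁻¹` (the remark that Lemma 3.5 applied to `Φ` and to `Φ̄` covers both exponent signs);
* `prod_conj_div_norm_eq_prod_zpow` — the product over a CM type `Φ`: DR's `∏_{v∈Φ} z̄_v/|z_v|` is Liu's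
  `∏_{v∈Φ} arg(z_v)^{−1}`.

Nothing here says anything about the status of the Hodge conjecture for CM abelian varieties, which is NOT proved.
-/

set_option autoImplicit false

namespace HodgeRepro

namespace T3.ArchimedeanConvention

open Complex ComplexConjugate

/-- `z z̄` is the real number `|z|²` (`normSq z`). -/
theorem mul_conj_re (z : ℂ) : (z * conj z).re = normSq z := by
  rw [mul_conj, ofReal_re]

/-- `√(normSq z) = ‖z‖`. -/
theorem sqrt_normSq_eq_norm (z : ℂ) : Real.sqrt (normSq z) = ‖z‖ :=
  (norm_def z).symm

/-- Liu's `arg(z) := z / √(z z̄)` (print p0006:L6–7) is the unit-circle projection `z / ‖z‖`. -/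
theorem liu_arg_eq_div_norm (z : ℂ) :
    z / (Real.sqrt (z * conj z).re : ℂ) = z / (‖z‖ : ℂ) := by
  rw [mul_conj_re, sqrt_normSq_eq_norm]

/-- `z / ‖z‖` lies on the unit circle for `z ≠ 0`. -/
theorem norm_div_norm {z : ℂ} (hz : z ≠ 0) : ‖z / (‖z‖ : ℂ)‖ = 1 := by
  rw [norm_div, norm_real, norm_norm, div_self (norm_ne_zero_iff.mpr hz)]

/-- **`z̄ / |z| = (z / |z|)⁻¹`** for `z ≠ 0`: `z̄ · z = |z|²`. -/
theorem conj_div_norm_eq_inv {z : ℂ} (hz : z ≠ 0) : conj z / (‖z‖ : ℂ) = (z / (‖z‖ : ℂ))⁻¹ := by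
  have hn : (‖z‖ : ℂ) ≠ 0 := by exact_mod_cast norm_ne_zero_iff.mpr hz
  rw [inv_div, div_eq_div_iff hn hz, ← normSq_eq_conj_mul_self, ← ofReal_mul, norm_mul_self_eq_normSq]

/-- Liu's `arg(z)^{−w_τ}` at `w_τ = 1` is DR's `z̄ / |z|`. -/
theorem zpow_neg_one_div_norm {z : ℂ} (hz : z ≠ 0) :
    (z / (‖z‖ : ℂ)) ^ (-1 : ℤ) = conj z / (‖z‖ : ℂ) := by
  rw [zpow_neg_one, conj_div_norm_eq_inv hz]

/-- Liu's `arg(z)^{−w}` is `(z̄ / |z|)^w` for every weight `w`. -/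
theorem zpow_neg_natCast_div_norm {z : ℂ} (hz : z ≠ 0) (w : ℕ) :
    (z / (‖z‖ : ℂ)) ^ (-(w : ℤ)) = (conj z / (‖z‖ : ℂ)) ^ w := by
  rw [zpow_neg, zpow_natCast, ← inv_pow, conj_div_norm_eq_inv hz]

/-- DR's formula at the conjugate embedding reverses the exponent: `conj(z̄) / |z̄| = z / |z| = (z̄ / |z|)⁻¹`
(Lemma 3.5 applied to `Φ̄` in place of `Φ`). -/
theorem conj_div_norm_conj {z : ℂ} (hz : z ≠ 0) :
    conj (conj z) / (‖conj z‖ : ℂ) = (conj z / (‖z‖ : ℂ))⁻¹ := by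
  rw [Complex.conj_conj, norm_conj, conj_div_norm_eq_inv hz, inv_inv]

/-- The product over a CM type `Φ`: DR's `∏_{v∈Φ} z̄_v / |z_v|` is Liu's `∏_{v∈Φ} arg(z_v)^{−1}`. -/
theorem prod_conj_div_norm_eq_prod_zpow {ι : Type*} (Φ : Finset ι) (z : ι → ℂ)
    (hz : ∀ v ∈ Φ, z v ≠ 0) :
    ∏ v ∈ Φ, conj (z v) / (‖z v‖ : ℂ) = ∏ v ∈ Φ, (z v / (‖z v‖ : ℂ)) ^ (-1 : ℤ) :=
  Finset.prod_congr rfl fun v hv => (zpow_neg_one_div_norm (hz v hv)).symm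

end T3.ArchimedeanConvention

end HodgeRepro
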